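import Summits.ResolutionOfSingularities.ResolutionOfSingularities.Theorems.HomologicalConductorNoZenoRMinimalOfCriterionM
import Summits.ResolutionOfSingularities.ResolutionOfSingularities.Theorems.HomologicalConductorNoZenoRFirstKindDisjoint
import HarnessLib

/-!
# Crux `NoZenoR` (stmt-ResolutionOfSingularities-19943) — Lipman (27.3) «⇐» and the EXISTENCE OF THE MINIMAL
# DESINGULARIZATION of `Spec S` from (27.1) ALONE: the one-step exercise bypassed

Route `ResolutionOfSingularities/HomologicalConductor` (cell decomp-res, hand leafhand-res-homologicalconduct-18 g1).
OURS: AI-written proof over tree theorems, weaker than expert review; nothing here is a statement of the manuscript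
under review (Hironaka 2017).  SUPPORT level, counted 0.  Def-free, no new named facts; FACT-PARAMETRIC in
`Lipman1969_27_1_reg_rat` where stated.

Lipman's numerical exercise (p. 278) is replaced by a DISJOINTNESS argument: along Zariski's factorisation of an
`S`-morphism `q : W → X` of desingularizations into point blow-downs, a first-kind curve `F ⊆ W` that `q` does not
contract is, at each blow-down `b : X₂ → X₁`, distinct from the (first-kind) exceptional curve of `b`, hence DISJOINT from
it (`disjoint_closure_of_firstKind`: negative definiteness), hence carried isomorphically: its image stays of the first
kind.  So a desingularization `X` satisfying (M) (no first-kind curve) admits no such `q` — Case A of Lipman's second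
paragraph — and `isMinimalResolution_of_criterionM_of_hex`'s remaining binder disappears.

* `firstKind_image_of_blowup_point` — transport of the first-kind numbers past ONE point blow-down missing the curve;
* `firstKind_image` — along any `S`-morphism of desingularizations not contracting the curve;
* **`isMinimalResolution_of_criterionM`** — (M) ⇒ `IsMinimalResolution`, UNCONDITIONAL;
* **`exists_isMinimalResolution_of_27_1`** — `Spec S` has a minimal desingularization, from `Lipman1969_27_1_reg_rat`;
* (the biconditional `Lipman1969_27_3_rat` from (27.1) alone is hand 16 g3's `ExcCount.FirstKind.Lipman1969_27_3_rat_of_27_1`,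
  landed concurrently on this hand's `Lipman1969_27_3_rat_of_27_1_of_exists_minimal`; the «⇐» half is print-free here).

No crux or summit statement is proved here.
-/

noncomputable section

-- single-problem summit: the doubled namespace component `ResolutionOfSingularities` is forced
set_option linter.dupNamespace false

open CategoryTheory AlgebraicGeometry TopologicalSpace Topology IsLocalRing
open Literature.AlgebraicGeometry.Resolution
open Scheme.IdealSheafData
open Summit.ResolutionOfSingularities.ResolutionOfSingularities.Theorems.NoZeno.ExcCount
open Summit.ResolutionOfSingularities.ResolutionOfSingularities.Theorems.NoZeno.ExcCount.FirstKind

namespace Summit.ResolutionOfSingularities.ResolutionOfSingularities.Theorems.NoZeno.FirstKind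

variable {S : Type} [CommRing S] [IsNoetherianRing S] [IsLocalRing S] [IsDomain S] [IsIntegrallyClosed S]

omit [IsNoetherianRing S] [IsLocalRing S] [IsDomain S] [IsIntegrallyClosed S] in
/-- **`h⁰`-numbers are carried past a point blow-down that misses the curve.**  `b : X₂ → X₁` an `S`-morphism of
desingularizations which is an isomorphism off the closed point `y`, `η₂ ∈ X₂` with `cl{η₂}` disjoint from `b⁻¹(y)`:
for every `k ≥ 1`, `h0 π₁ (𝓘_{b η₂}^k) = h0 (b ≫ π₁) (𝓘_{η₂}^k)` (both sides are computed on the isomorphic opens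
`b⁻¹(X₁ ∖ y) ⥲ X₁ ∖ y` containing the two curves, `PointBlowup.h0_comap_of_isOpenImmersion`). [folklore] -/
theorem h0_pow_image_eq_of_disjoint {X₁ X₂ : Scheme.{0}} {π₁ : X₁ ⟶ Spec (.of S)} {b : X₂ ⟶ X₁}
    (hπ₁ : IsResolution π₁) (hbπ : IsResolution (b ≫ π₁)) {y : X₁} (hy : IsClosed ({y} : Set X₁))
    [IsIso (b ∣_ (⟨{y}ᶜ, hy.isOpen_compl⟩ : X₁.Opens))] {η₂ : X₂}
    (hdisj : Disjoint (closure ({η₂} : Set X₂)) (b.base ⁻¹' {y})) {k : ℕ} (hk : k ≠ 0) :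
    h0 π₁ (primeDivisorIdeal (b.base η₂) ^ k) = h0 (b ≫ π₁) (primeDivisorIdeal η₂ ^ k) := by
  haveI : IsProper π₁ := hπ₁.isProper
  haveI : IsProper (b ≫ π₁) := hbπ.isProper
  haveI : IsProper b := IsProper.of_comp b π₁
  set U : X₁.Opens := ⟨{y}ᶜ, hy.isOpen_compl⟩ with hU
  set V : X₂.Opens := b ⁻¹ᵁ U with hV
  -- the open immersion `j : V → X₁`
  have hj : V.ι ≫ b = (b ∣_ U) ≫ U.ι := (morphismRestrict_ι b U).symm
  haveI : IsOpenImmersion (V.ι ≫ b) := by rw [hj]; infer_instance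
  -- supports
  have hcl₂ : closure ({η₂} : Set X₂) ⊆ (V : Set X₂) := fun w hw hwy =>
    Set.disjoint_left.mp hdisj hw hwy
  have hη₂V : η₂ ∈ V := hcl₂ (subset_closure rfl)
  have hcl₁ : closure ({b.base η₂} : Set X₁) ⊆ Set.range (V.ι ≫ b).base := by
    have himg : closure ({b.base η₂} : Set X₁) = b.base '' closure {η₂} := by
      rw [← Set.image_singleton, b.isClosedMap.closure_image_eq_of_continuous b.continuous]
    rw [himg]
    rintro _ ⟨w, hw, rfl⟩
    exact ⟨⟨w, hcl₂ hw⟩, rfl⟩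
  have hs₁ : ((primeDivisorIdeal (b.base η₂) ^ k).support : Set X₁) ⊆ Set.range (V.ι ≫ b).base := by
    rw [Scheme.IdealSheafData.support_pow _ _ hk, coe_support_primeDivisorIdeal]; exact hcl₁
  have hs₂ : ((primeDivisorIdeal η₂ ^ k).support : Set X₂) ⊆ Set.range V.ι.base := by
    rw [Scheme.IdealSheafData.support_pow _ _ hk, coe_support_primeDivisorIdeal, Scheme.Opens.range_ι]; exact hcl₂
  -- compute both sides on `V`
  rw [← PointBlowup.h0_comap_of_isOpenImmersion π₁ (V.ι ≫ b) _ hs₁,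
    ← PointBlowup.h0_comap_of_isOpenImmersion (b ≫ π₁) V.ι _ hs₂,
    Literature.AlgebraicGeometry.Resolution.comap_pow, Literature.AlgebraicGeometry.Resolution.comap_pow]
  have h1 : (primeDivisorIdeal (b.base η₂)).comap (V.ι ≫ b) = primeDivisorIdeal (⟨η₂, hη₂V⟩ : V) :=
    comap_primeDivisorIdeal_of_isOpenImmersion (V.ι ≫ b) ⟨η₂, hη₂V⟩
  have h2 : (primeDivisorIdeal η₂).comap V.ι = primeDivisorIdeal (⟨η₂, hη₂V⟩ : V) :=
    comap_primeDivisorIdeal_of_isOpenImmersion V.ι ⟨η₂, hη₂V⟩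
  rw [h1, h2, Category.assoc]

/-- **The image of a non-contracted first-kind curve under an `S`-morphism of desingularizations is of the first
kind.**  `S` a two-dimensional Noetherian local normal domain with a rational singularity, `π : X → Spec S` and
`q ≫ π : W → Spec S` desingularizations, `η′ ∈ excCurvePoints (q ≫ π)` of the first kind with `q η′` NOT closed: then
`q η′ ∈ excCurvePoints π` is of the first kind.  Induction along the one-step descent: past each point blow-down the
curve is distinct from, hence DISJOINT from, the first-kind exceptional curve (`disjoint_closure_of_firstKind`), so its
numbers are unchanged (`h0_pow_image_eq_of_disjoint`). [cite: Lipman1969, Corollary (27.3), proof (p. 278)] -/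
theorem firstKind_image (h2 : ringKrullDim S = 2) (hS : HasRationalSingularity S) {X : Scheme.{0}}
    {π : X ⟶ Spec (.of S)} (hπ : IsResolution π) :
    ∀ (W : Scheme.{0}) (q : W ⟶ X), IsResolution (q ≫ π) → ∀ η' ∈ excCurvePoints (q ≫ π),
      ¬ IsClosed ({q.base η'} : Set X) →
      h0 (q ≫ π) (primeDivisorIdeal η' ^ 2) = 3 * h0 (q ≫ π) (primeDivisorIdeal η') →
      q.base η' ∈ excCurvePoints π ∧
        h0 π (primeDivisorIdeal (q.base η') ^ 2) = 3 * h0 π (primeDivisorIdeal (q.base η')) := by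
  suffices H : ∀ (k : ℕ) (X : Scheme.{0}) (π : X ⟶ Spec (.of S)), IsResolution π →
      ∀ (W : Scheme.{0}) (q : W ⟶ X), IsResolution (q ≫ π) →
      (excCurvePoints (q ≫ π)).ncard ≤ (excCurvePoints π).ncard + k → ∀ η' ∈ excCurvePoints (q ≫ π),
      ¬ IsClosed ({q.base η'} : Set X) →
      h0 (q ≫ π) (primeDivisorIdeal η' ^ 2) = 3 * h0 (q ≫ π) (primeDivisorIdeal η') →
      q.base η' ∈ excCurvePoints π ∧
        h0 π (primeDivisorIdeal (q.base η') ^ 2) = 3 * h0 π (primeDivisorIdeal (q.base η')) from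
    fun W q hq η' hη' hncl hfk => H _ X π hπ W q hq (Nat.le_add_left _ _) η' hη' hncl hfk
  -- the image point is an exceptional curve as soon as it is not closed
  have hexc : ∀ (X : Scheme.{0}) (π : X ⟶ Spec (.of S)), IsResolution π → ∀ (W : Scheme.{0}) (q : W ⟶ X),
      ∀ η' ∈ excCurvePoints (q ≫ π), ¬ IsClosed ({q.base η'} : Set X) → q.base η' ∈ excCurvePoints π := by
    intro X π hπ W q η' hη' hncl
    have hover : π.base (q.base η') = closedPoint S := by rw [← Scheme.Hom.comp_apply]; exact hη'.1
    refine ⟨hover, le_antisymm (hπ.height_le_one_of_base_eq_closedPoint h2 hover) ?_⟩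
    exact Order.one_le_iff_ne_zero.mpr fun h0 => hncl (isClosed_singleton_of_height_eq_zero' h0)
  -- transport along an isomorphism
  have hisoCase : ∀ (X : Scheme.{0}) (π : X ⟶ Spec (.of S)) (W : Scheme.{0}) (q : W ⟶ X), IsIso q →
      ∀ η' : W, h0 (q ≫ π) (primeDivisorIdeal η' ^ 2) = 3 * h0 (q ≫ π) (primeDivisorIdeal η') →
      h0 π (primeDivisorIdeal (q.base η') ^ 2) = 3 * h0 π (primeDivisorIdeal (q.base η')) := by
    intro X π W q hq η' hfk
    have hsupp : ∀ K : X.IdealSheafData, (K.support : Set X) ⊆ Set.range q.base :=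
      fun K z _ => (Scheme.homeoOfIso (asIso q)).surjective z
    rw [← PointBlowup.h0_comap_of_isOpenImmersion π q _ (hsupp _),
      ← PointBlowup.h0_comap_of_isOpenImmersion π q _ (hsupp _), Literature.AlgebraicGeometry.Resolution.comap_pow,
      comap_primeDivisorIdeal_of_isOpenImmersion q η']
    exact hfk
  intro k
  induction k with
  | zero =>
    intro X π hπ W q hq hle η' hη' hncl hfk
    have hiso : IsIso q := by
      by_contra hne
      have := ncard_excCurvePoints_succ_le_of_not_isIso h2 hq hπ rfl hne
      omega
    exact ⟨hexc X π hπ W q η' hη' hncl, hisoCase X π W q hiso η' hfk⟩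
  | succ k ih =>
    intro X π hπ W q hq hle η' hη' hncl hfk
    refine ⟨hexc X π hπ W q η' hη' hncl, ?_⟩
    by_cases hiso : IsIso q
    · exact hisoCase X π W q hiso η' hfk
    obtain ⟨y, hy, hy2, X₁, b, q₁, hb, hq₁, hbπ⟩ := step h2 hq hπ hiso
    haveI : IsProper (b ≫ π) := hbπ.isProper
    haveI : IsProper π := hπ.isProper
    haveI : IsProper b := IsProper.of_comp b π
    haveI : IsIntegral X := hπ.isIntegral_source
    haveI : IsIntegral X₁ := hbπ.isIntegral_source
    have hbq₁ : b.base (q₁.base η') = q.base η' := by rw [← Scheme.Hom.comp_apply, hq₁]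
    -- the intermediate point is not closed (its image is not)
    have hncl₁ : ¬ IsClosed ({q₁.base η'} : Set X₁) := fun hcl => by
      apply hncl
      rw [← hbq₁, ← Set.image_singleton]
      exact b.isClosedMap _ hcl
    -- induction hypothesis on `q₁ : W → X₁`
    have hq' : IsResolution (q₁ ≫ b ≫ π) := by rw [← Category.assoc, hq₁]; exact hq
    have hc2 := ncard_excCurvePoints_blowup_point h2 π hπ hy hy2 b hb hbπ
    obtain ⟨hη₁, hfk₁⟩ := ih X₁ (b ≫ π) hbπ W q₁ hq' (by
      have : (excCurvePoints (q₁ ≫ b ≫ π)).ncard = (excCurvePoints (q ≫ π)).ncard := by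
        rw [← Category.assoc, hq₁]
      omega) η' (by rw [← Category.assoc, hq₁]; exact hη') hncl₁ (by rw [← Category.assoc, hq₁]; exact hfk)
    -- the exceptional curve of `b` is of the first kind and DIFFERENT, hence disjoint
    obtain ⟨ε, hε, hcl, hId⟩ := exists_mem_excCurvePoints_blowup_point h2 π hπ hy hy2 b hb hbπ
    haveI : IsLocallyNoetherian X := LocallyOfFiniteType.isLocallyNoetherian π
    haveI : IsRegularLocalRing (X.presheaf.stalk y) := hπ.isRegular y
    have hfkε : h0 (b ≫ π) (primeDivisorIdeal ε ^ 2) = 3 * h0 (b ≫ π) (primeDivisorIdeal ε) := by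
      rw [hId]; exact PointBlowup.h0_comap_vanishingIdeal_point_sq_eq_three_mul π b y hy hy2 hb
    have hne : q₁.base η' ≠ ε := by
      intro heq
      have hεy : b.base ε = y := by
        have : ε ∈ b.base ⁻¹' {y} := hcl ▸ subset_closure (Set.mem_singleton ε)
        exact this
      apply hncl
      rw [← hbq₁, heq, hεy]; exact hy
    have hdisj := disjoint_closure_of_firstKind h2 hS hbπ hη₁ hε hne hfk₁ hfkε
    rw [hcl] at hdisj
    -- `b` is an isomorphism off `y`
    have hU : (⟨((vanishingIdeal (⟨{y}, hy⟩ : Closeds X)).support : Set X)ᶜ,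
        (vanishingIdeal (⟨{y}, hy⟩ : Closeds X)).support.isClosed.isOpen_compl⟩ : X.Opens) =
        ⟨{y}ᶜ, hy.isOpen_compl⟩ :=
      TopologicalSpace.Opens.ext (by
        rw [TopologicalSpace.Opens.coe_mk, TopologicalSpace.Opens.coe_mk,
          Scheme.IdealSheafData.coe_support_vanishingIdeal]; rfl)
    haveI : IsIso (b ∣_ (⟨{y}ᶜ, hy.isOpen_compl⟩ : X.Opens)) :=
      ((MorphismProperty.isomorphisms Scheme).arrow_mk_iso_iff (morphismRestrictEq b hU)).mp hb.isIso_compl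
    have h1 := h0_pow_image_eq_of_disjoint hπ hbπ hy hdisj one_ne_zero
    rw [pow_one, pow_one] at h1
    rw [← hbq₁, h0_pow_image_eq_of_disjoint hπ hbπ hy hdisj two_ne_zero, h1]
    exact hfk₁

/-- **Lipman (27.3) «⇐» WITHOUT (4.1), UNCONDITIONAL: criterion (M) ⇒ minimal.**  For `S` a two-dimensional
Noetherian local normal domain with a rational singularity and a desingularization `π : X → Spec S` with
`3·h⁰(𝓘_η) < h⁰(𝓘_η²)` for every integral exceptional curve, every desingularization of `Spec S` factors through `π`
(Lipman p. 278 ¶2: common domination with fewest curves, top quadratic transformation, descent in the contracting case,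
and — in place of the intersection exercise — `firstKind_image` in the non-contracting case).
[cite: Lipman1969, Corollary (27.3) (p. 277; proof pp. 277–278)] -/
theorem isMinimalResolution_of_criterionM (h2 : ringKrullDim S = 2) (hS : HasRationalSingularity S)
    {X : Scheme.{0}} {π : X ⟶ Spec (.of S)} (hπ : IsResolution π)
    (hM : ∀ η ∈ excCurvePoints π, 3 * h0 π (primeDivisorIdeal η) < h0 π (primeDivisorIdeal η ^ 2)) :
    IsMinimalResolution π := by
  haveI : IsIntegral X := hπ.isIntegral_source
  haveI : IsProper π := hπ.isProper
  -- P(n): every `Z₁` dominated, together with `X`, by some `W` with at most `n` exceptional curves factors through `π`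
  suffices H : ∀ (n : ℕ) (W Z₁ : Scheme.{0}) (g₁ : Z₁ ⟶ Spec (.of S)) (j : W ⟶ Z₁) (q : W ⟶ X),
      IsResolution g₁ → IsResolution (j ≫ g₁) → q ≫ π = j ≫ g₁ → (excCurvePoints (j ≫ g₁)).ncard ≤ n →
      ∃ k : Z₁ ⟶ X, k ≫ π = g₁ by
    refine ⟨hπ, fun Z₁ g₁ hg₁ => ?_⟩
    haveI : IsIntegral Z₁ := hg₁.isIntegral_source
    obtain ⟨W, j, q, -, -, hj, hfac⟩ :=
      Lipman12B.exists_isPointBlowupComposition_dominating_of_ringKrullDim_le_two h2.le g₁ hg₁ π hπ.isBirational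
    exact H _ W Z₁ g₁ j q hg₁ (isResolution_comp_of_isResolution hj hg₁) hfac le_rfl
  intro n
  induction n with
  | zero =>
    intro W Z₁ g₁ j q hg₁ hjg hfac hle
    by_cases hj : IsIso j
    · exact ⟨inv j ≫ q, by rw [Category.assoc, hfac, IsIso.inv_hom_id_assoc]⟩
    · have := ncard_excCurvePoints_succ_le_of_not_isIso h2 hjg hg₁ rfl hj
      omega
  | succ n ih =>
    intro W Z₁ g₁ j q hg₁ hjg hfac hle
    by_cases hj : IsIso j
    · exact ⟨inv j ≫ q, by rw [Category.assoc, hfac, IsIso.inv_hom_id_assoc]⟩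
    -- split off the top quadratic transformation of `j`
    obtain ⟨W₁, ρ₁, σ, x', hx', W', τ, e, he, hρ₁, hσ, hx'2, hτ, hτρ₁, hjfac⟩ :=
      exists_top_fac h2 hjg Z₁ g₁ j hg₁ rfl hj
    haveI : IsIntegral W₁ := hρ₁.isIntegral_source
    haveI : IsIntegral W' := hτρ₁.isIntegral_source
    haveI : IsProper ρ₁ := hρ₁.isProper
    haveI : IsLocallyNoetherian W₁ := LocallyOfFiniteType.isLocallyNoetherian ρ₁
    haveI : IsRegularLocalRing (W₁.presheaf.stalk x') := hρ₁.isRegular x'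
    -- `q' : W' → X` and its structure equation
    set q' : W' ⟶ X := inv e ≫ q with hq'def
    have hq' : q' ≫ π = τ ≫ ρ₁ := by
      rw [hq'def, Category.assoc, hfac, ← hjfac]
      simp only [Category.assoc, IsIso.inv_hom_id_assoc, hσ]
    have hq'res : IsResolution (q' ≫ π) := by rw [hq']; exact hτρ₁
    -- the exceptional curve `F = cl{ε}` of `τ`, of the first kind
    obtain ⟨ε, hε, hcl, hId⟩ := exists_mem_excCurvePoints_blowup_point h2 ρ₁ hρ₁ hx' hx'2 τ hτ hτρ₁
    have hfirst : h0 (τ ≫ ρ₁) (primeDivisorIdeal ε ^ 2) = 3 * h0 (τ ≫ ρ₁) (primeDivisorIdeal ε) := by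
      rw [hId]
      exact PointBlowup.h0_comap_vanishingIdeal_point_sq_eq_three_mul ρ₁ τ x' hx' hx'2 hτ
    by_cases hclosed : IsClosed ({q'.base ε} : Set X)
    · -- Case B: `q'` contracts `F`; it descends to `W₁`, which dominates both with fewer curves
      have hcontr : ∀ w : W', τ.base w = x' → q'.base w = q'.base ε := by
        intro w hw
        have hwcl : w ∈ closure ({ε} : Set W') := by rw [hcl]; exact hw
        have : q'.base w ∈ closure ({q'.base ε} : Set X) := by
          have := image_closure_subset_closure_image q'.continuous ⟨w, hwcl, rfl⟩
          rwa [Set.image_singleton] at this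
        rwa [hclosed.closure_eq, Set.mem_singleton_iff] at this
      -- `τ` is an isomorphism off `x'`
      have hU : (⟨((vanishingIdeal (⟨{x'}, hx'⟩ : Closeds W₁)).support : Set W₁)ᶜ,
          (vanishingIdeal (⟨{x'}, hx'⟩ : Closeds W₁)).support.isClosed.isOpen_compl⟩ : W₁.Opens) =
          ⟨{x'}ᶜ, hx'.isOpen_compl⟩ :=
        TopologicalSpace.Opens.ext (by
          rw [TopologicalSpace.Opens.coe_mk, TopologicalSpace.Opens.coe_mk,
            Scheme.IdealSheafData.coe_support_vanishingIdeal]; rfl)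
      haveI : IsIso (τ ∣_ (⟨{x'}ᶜ, hx'.isOpen_compl⟩ : W₁.Opens)) :=
        ((MorphismProperty.isomorphisms Scheme).arrow_mk_iso_iff (morphismRestrictEq τ hU)).mp hτ.isIso_compl
      obtain ⟨q₁, hq₁⟩ := exists_desc_of_contracts hρ₁ hτρ₁ q' hx' hcontr
      -- `q₁ ≫ π = ρ₁ = σ ≫ g₁` (cancel `τ` on global sections: maps into the affine `Spec S`)
      have hq₁π : q₁ ≫ π = ρ₁ := by
        haveI h1 : IsIso (τ ≫ ρ₁).appTop := hτρ₁.isIso_appTop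
        haveI h2' : IsIso ρ₁.appTop := hρ₁.isIso_appTop
        haveI : IsIso τ.appTop := by
          rw [Scheme.Hom.comp_appTop] at h1
          exact IsIso.of_isIso_comp_left ρ₁.appTop τ.appTop
        refine ext_of_isAffine ?_
        rw [← cancel_mono τ.appTop, ← Scheme.Hom.comp_appTop, ← Scheme.Hom.comp_appTop, ← Category.assoc, hq₁,
          hq']
      -- count: `#exc ρ₁ + 1 ≤ #exc (τ ≫ ρ₁) = #exc (j ≫ g₁)`
      have hc2 := ncard_excCurvePoints_blowup_point h2 ρ₁ hρ₁ hx' hx'2 τ hτ hτρ₁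
      have heq : (excCurvePoints (j ≫ g₁)).ncard = (excCurvePoints (τ ≫ ρ₁)).ncard := by
        have hres : IsResolution (e ≫ τ ≫ ρ₁) := by
          have h' : e ≫ τ ≫ ρ₁ = j ≫ g₁ := by rw [← hjfac, ← hσ]; simp only [Category.assoc]
          rw [h']; exact hjg
        have := (isIso_iff_ncard_excCurvePoints_eq h2 hres hτρ₁ rfl).mp he
        rw [← this, ← hjfac, Category.assoc, Category.assoc, hσ]
      have hρ₁' : IsResolution (σ ≫ g₁) := by rw [hσ]; exact hρ₁
      refine ih W₁ Z₁ g₁ σ q₁ hg₁ hρ₁' (by rw [hq₁π, hσ]) ?_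
      rw [hσ]; omega
    · -- Case A: `F` is the strict transform of an exceptional curve of `X` satisfying (M): contradiction
      exfalso
      have hover : (q' ≫ π).base ε = closedPoint S := by rw [hq']; exact hε.1
      have hqε : q'.base ε ∈ excCurvePoints π := by
        have hover' : π.base (q'.base ε) = closedPoint S := by rw [← Scheme.Hom.comp_apply]; exact hover
        refine ⟨hover', le_antisymm (hπ.height_le_one_of_base_eq_closedPoint h2 hover') ?_⟩
        exact Order.one_le_iff_ne_zero.mpr fun h0 => hclosed (isClosed_singleton_of_height_eq_zero' h0)
      have hε' : ε ∈ excCurvePoints (q' ≫ π) := by rw [hq']; exact hε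
      have hfirst' : h0 (q' ≫ π) (primeDivisorIdeal ε ^ 2) = 3 * h0 (q' ≫ π) (primeDivisorIdeal ε) := by
        rw [hq']; exact hfirst
      obtain ⟨-, hfkX⟩ := firstKind_image h2 hS hπ W' q' hq'res ε hε' hclosed hfirst'
      have hlt := hM _ hqε
      rw [hfkX] at hlt
      exact lt_irrefl _ hlt


/-- **THE MINIMAL DESINGULARIZATION OF `Spec S` EXISTS, from (27.1) alone** (`S` a two-dimensional Noetherian local
normal domain with a rational singularity): the relatively minimal model below any desingularization satisfies (M) under
(27.1) (`exists_criterionM_of_27_1`), hence is minimal (`isMinimalResolution_of_criterionM`).  This is the LOCAL form of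
Lipman's Theorem (4.1) consumed by the crux (`stub_minResolutionExists`), now resting on `Lipman1969_27_1_reg_rat` only.
[cite: Lipman1969, Theorem (4.1) (p. 204) and Corollary (27.3) (p. 277)] -/
theorem exists_isMinimalResolution_of_27_1 (h271 : Lipman1969_27_1_reg_rat.{0}) (h2 : ringKrullDim S = 2)
    (hS : HasRationalSingularity S) :
    ∃ (X : Scheme.{0}) (π : X ⟶ Spec (.of S)), IsMinimalResolution π := by
  obtain ⟨X, π, hπ, hMX⟩ := exists_criterionM_of_27_1 h271 h2 hS
  exact ⟨X, π, isMinimalResolution_of_criterionM h2 hS hπ hMX⟩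

end Summit.ResolutionOfSingularities.ResolutionOfSingularities.Theorems.NoZeno.FirstKind

end
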